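import Mathlib

/-!
# EriceRemainderEnclosureSegmentNormalFamily — (E19a) A NORMAL FAMILY ON A CLOSED SEGMENT: uniform convergence at order 0 and ONE
# n-free bound per order ⟹ UNIFORM convergence at EVERY order, the limit C^∞ on the closed segment with the same bounds — by the
# Landau–Kolmogorov interpolation |d′| ≤ 2G∕h + K·h (no Arzelà–Ascoli, no Vitali–Montel); the bound TWO orders up is load-bearing
# (witness sin((n+1)s)∕(n+1)).  The real-variable core of (E19) `EriceRemainderEnclosureHolomorphyLimit`.

Cell `pub-balaban`, β-function sub-cell, BINDER row D4 «RemainderConst leaves for Bałaban's split» (`HOME/BINDER-OWNERS.md`; owner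
lineage `b2b-balaban-beta-an4`; this file by co-owner #2 lineage `b2b-balaban-beta-d4-p2` (MODEL crew), generation 24), β-FLOW TEAM
duty (1); FREEZE (0) honoured (def-free module in the lineage's own `EriceRemainderEnclosure*` series; no leaf, no interface; pure
Mathlib, no project import).  OCCASION: the analytic alternative of [I] p. 266 tl.33–37 read on the real coupling segment — see the
companion (E19) for the Erice side; bflow-p1's J-P1-27 recorded the convergence of the derivatives ALONG the segment as «Vitali-type,
not in anyone's file»; this is its elementary real-variable engine.

HONEST FRAMING (BETA-SPEC §0.2, verbatim and binding). *"Discharging BetaPertH makes Bałaban's UV stability UNCONDITIONAL — a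
real constructive-QFT result; it is NOT the continuum limit and NOT the Clay problem."*  This module discharges NOTHING of the kind:
folklore real analysis (mean-value inequality, interpolation on a segment of length ≥ 2h, completeness of ℝ) on plain real
functions; nothing of Bałaban's (1.22) or of Bałaban–Jaffe's β_n is mentioned, asserted, constructed or instantiated; row D4 class
UNCHANGED (critical-path width 0; instance 0∕1; D4 DISCHARGE NO DATE).  NOT B12 Thm 2, NOT BetaPertH, NOT continuum, NOT Clay.
HONEST DEPENDENCY: continuum YM on T⁴ ⇐ BetaPertH ∧ nine spine estimates (0/9 proved); BetaPertH ⇐ (D1) ∧ (D4) ∧ CAP+tail;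
G-an2-4 gates asym, D1 and NE2/3/4.

WHAT IS PROVED ([folklore]; 0 sorry; 0 `def`).
* §1 on a segment `[a, b]`: `abs_sub_le_of_hasDerivWithin_bound` (derivative bound ⟹ Lipschitz), `taylor2_of_lipschitz_deriv`
  (Lipschitz derivative ⟹ |g(y) − g(x) − (y−x)g′(x)| ≤ L|y−x|² at EVERY base point), the LANDAU–KOLMOGOROV step
  `abs_le_interpolation` (|g′| ≤ 2G∕h + K·h from |g| ≤ G and a quadratic Taylor bound K; 0 < h, a + 2h ≤ b).
* §2 a family `u n m : ℝ → ℝ` (scale n, order m) with `HasDerivWithinAt (u n m) (u n (m+1) x) [a,b] x` and ONE bound `|u n m| ≤ A m`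
  uniform in n: `fam_lipschitz`, `fam_taylor2` (constant `A (m+2)`), `fam_diff_taylor2`, **`uniformCauchySeqOn_succ`** (uniform
  Cauchy-ness LIFTS from order m to order m + 1, a < b), `uniformCauchySeqOn_all`, **`allOrders_limit`** (`u · 0 → f` uniformly on
  [a, b] ⟹ there are `D m` with `D 0 = f` on [a, b], `u · m → D m` UNIFORMLY for every m, `|D m| ≤ A m`,
  `|D m(y) − D m(x) − (y−x)·D (m+1)(x)| ≤ A (m+2)|y−x|²`, `HasDerivWithinAt (D m) (D (m+1) x) [a,b] x` — the limit is C^∞ on the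
  CLOSED segment with the same bounds).
* §3 NECESSITY (MODEL crew): `unifConv_firstOrder_not_sufficient` — β_n(s) = sin((n+1)s)∕(n+1) → 0 UNIFORMLY on [0, 1],
  |β_n′| ≤ 1 uniformly in n, yet β_n′(0) = 1 for every n while the limit has derivative 0: uniform convergence + a uniform bound ONE
  order up ⇏ convergence of one coefficient; §2 consumes the bound TWO orders up.
* END `segmentNormalFamily_census`.
-/

noncomputable section

open Filter Topology Set Metric Asymptotics

namespace Summit.QuantumFields.BalabanUV.Beta.EriceRemainderEnclosureSegmentNormalFamily


/-! ## §1 Three real-variable lemmas on a segment -/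

/-- **Derivative bound ⟹ Lipschitz** on `[a, b]` (mean-value inequality, `Convex.norm_image_sub_le_of_norm_hasDerivWithin_le`).
[folklore] -/
theorem abs_sub_le_of_hasDerivWithin_bound {g g' : ℝ → ℝ} {a b B : ℝ}
    (hg : ∀ x ∈ Icc a b, HasDerivWithinAt g (g' x) (Icc a b) x) (hB : ∀ x ∈ Icc a b, |g' x| ≤ B)
    {x y : ℝ} (hx : x ∈ Icc a b) (hy : y ∈ Icc a b) : |g y - g x| ≤ B * |y - x| := by
  have h := Convex.norm_image_sub_le_of_norm_hasDerivWithin_le hg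
    (fun t ht => by rw [Real.norm_eq_abs]; exact hB t ht) (convex_Icc a b) hx hy
  rwa [Real.norm_eq_abs, Real.norm_eq_abs] at h

/-- **Lipschitz derivative ⟹ second-order Taylor bound at every base point**: if `g` has derivative `g′` within `[a, b]` and
`|g′(y) − g′(x)| ≤ L|y − x|` there (`L ≥ 0`), then `|g(y) − g(x) − (y − x)·g′(x)| ≤ L·|y − x|²` for all `x, y ∈ [a, b]` (mean value
for `t ↦ g(t) − t·g′(x)` on the segment between `x` and `y`). [folklore] -/
theorem taylor2_of_lipschitz_deriv {g g' : ℝ → ℝ} {a b L : ℝ} (hL : 0 ≤ L)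
    (hg : ∀ x ∈ Icc a b, HasDerivWithinAt g (g' x) (Icc a b) x)
    (hLip : ∀ x ∈ Icc a b, ∀ y ∈ Icc a b, |g' y - g' x| ≤ L * |y - x|)
    {x y : ℝ} (hx : x ∈ Icc a b) (hy : y ∈ Icc a b) :
    |g y - g x - (y - x) * g' x| ≤ L * |y - x| ^ 2 := by
  have hsub : uIcc x y ⊆ Icc a b := uIcc_subset_Icc hx hy
  have hder : ∀ t ∈ uIcc x y,
      HasDerivWithinAt (fun t => g t - t * g' x) (g' t - g' x) (uIcc x y) t := by
    intro t ht
    have h1 : HasDerivWithinAt g (g' t) (uIcc x y) t := (hg t (hsub ht)).mono hsub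
    have h2 : HasDerivWithinAt (fun t : ℝ => t * g' x) (1 * g' x) (uIcc x y) t :=
      (hasDerivWithinAt_id t _).mul_const (g' x)
    rw [one_mul] at h2
    exact h1.sub h2
  have hbd : ∀ t ∈ uIcc x y, ‖g' t - g' x‖ ≤ L * |y - x| := by
    intro t ht
    rw [Real.norm_eq_abs]
    calc |g' t - g' x| ≤ L * |t - x| := hLip x hx t (hsub ht)
      _ ≤ L * |y - x| := mul_le_mul_of_nonneg_left (abs_sub_left_of_mem_uIcc ht) hL
  have h := Convex.norm_image_sub_le_of_norm_hasDerivWithin_le hder hbd (convex_uIcc x y) left_mem_uIcc right_mem_uIcc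
  rw [Real.norm_eq_abs, Real.norm_eq_abs] at h
  have e : g y - y * g' x - (g x - x * g' x) = g y - g x - (y - x) * g' x := by ring
  rw [e] at h
  calc |g y - g x - (y - x) * g' x| ≤ L * |y - x| * |y - x| := h
    _ = L * |y - x| ^ 2 := by ring

/-- **THE LANDAU–KOLMOGOROV STEP on a segment of length ≥ 2h.**  If `|g| ≤ G` on `[a, b]`, `|g(y) − g(x) − (y − x)·g′(x)| ≤ K|y − x|²`
for `x, y ∈ [a, b]`, `0 < h` and `a + 2h ≤ b`, then `|g′(x)| ≤ 2G∕h + K·h` at every `x ∈ [a, b]` (take `y = x + h` or `y = x − h`,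
whichever lies in the segment). [folklore] -/
theorem abs_le_interpolation {g g' : ℝ → ℝ} {a b K G h : ℝ}
    (hT : ∀ x ∈ Icc a b, ∀ y ∈ Icc a b, |g y - g x - (y - x) * g' x| ≤ K * |y - x| ^ 2)
    (hG : ∀ x ∈ Icc a b, |g x| ≤ G) (hh : 0 < h) (hh2 : a + 2 * h ≤ b) {x : ℝ} (hx : x ∈ Icc a b) :
    |g' x| ≤ 2 * G / h + K * h := by
  obtain ⟨y, hy, hyx⟩ : ∃ y ∈ Icc a b, |y - x| = h := by
    by_cases hxh : x + h ≤ b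
    · exact ⟨x + h, ⟨by linarith [hx.1], hxh⟩, by rw [add_sub_cancel_left, abs_of_pos hh]⟩
    · exact ⟨x - h, ⟨by linarith [hx.2], by linarith [hx.2]⟩, by rw [sub_sub_cancel_left, abs_neg, abs_of_pos hh]⟩
  have h2 : |(y - x) * g' x| ≤ G + G + K * h ^ 2 := by
    have e : (y - x) * g' x = (g y - g x) - (g y - g x - (y - x) * g' x) := by ring
    rw [e]
    calc |(g y - g x) - (g y - g x - (y - x) * g' x)| ≤ |g y - g x| + |g y - g x - (y - x) * g' x| := abs_sub _ _
      _ ≤ (|g y| + |g x|) + K * |y - x| ^ 2 := add_le_add (abs_sub _ _) (hT x hx y hy)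
      _ ≤ (G + G) + K * h ^ 2 := by rw [hyx]; gcongr; exacts [hG y hy, hG x hx]
  rw [abs_mul, hyx] at h2
  have h3 : |g' x| ≤ (G + G + K * h ^ 2) / h := by
    rw [le_div_iff₀ hh]; linarith [h2]
  calc |g' x| ≤ (G + G + K * h ^ 2) / h := h3
    _ = 2 * G / h + K * h := by field_simp; ring

/-! ## §2 A normal family on the segment: uniform convergence at order 0 ⟹ at every order -/

section Family

variable {u : ℕ → ℕ → ℝ → ℝ} {A : ℕ → ℝ} {a b : ℝ}
  (hu : ∀ n m, ∀ x ∈ Icc a b, HasDerivWithinAt (u n m) (u n (m + 1) x) (Icc a b) x)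
  (hA : ∀ n m, ∀ x ∈ Icc a b, |u n m x| ≤ A m)
include hu hA

/-- Each `u n m` is `A (m+1)`-Lipschitz on `[a, b]`. [folklore] -/
theorem fam_lipschitz (n m : ℕ) {x y : ℝ} (hx : x ∈ Icc a b) (hy : y ∈ Icc a b) :
    |u n m y - u n m x| ≤ A (m + 1) * |y - x| :=
  abs_sub_le_of_hasDerivWithin_bound (hu n m) (hA n (m + 1)) hx hy

/-- Second-order Taylor bound at every base point with the constant TWO orders up: `|u(y) − u(x) − (y−x)u′(x)| ≤ A (m+2)·|y−x|²`.
[folklore] -/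
theorem fam_taylor2 (n m : ℕ) {x y : ℝ} (hx : x ∈ Icc a b) (hy : y ∈ Icc a b) :
    |u n m y - u n m x - (y - x) * u n (m + 1) x| ≤ A (m + 2) * |y - x| ^ 2 :=
  taylor2_of_lipschitz_deriv ((abs_nonneg _).trans (hA n (m + 2) x hx)) (hu n m)
    (fun _ hx' _ hy' => fam_lipschitz hu hA n (m + 1) hx' hy') hx hy

/-- The same for a DIFFERENCE of two scales, constant `2·A (m+2)`. [folklore] -/
theorem fam_diff_taylor2 (n k m : ℕ) {x y : ℝ} (hx : x ∈ Icc a b) (hy : y ∈ Icc a b) :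
    |(u n m y - u k m y) - (u n m x - u k m x) - (y - x) * (u n (m + 1) x - u k (m + 1) x)|
      ≤ 2 * A (m + 2) * |y - x| ^ 2 := by
  have h1 := fam_taylor2 hu hA n m hx hy
  have h2 := fam_taylor2 hu hA k m hx hy
  have e : (u n m y - u k m y) - (u n m x - u k m x) - (y - x) * (u n (m + 1) x - u k (m + 1) x)
      = (u n m y - u n m x - (y - x) * u n (m + 1) x) - (u k m y - u k m x - (y - x) * u k (m + 1) x) := by ring
  rw [e]
  calc _ ≤ |u n m y - u n m x - (y - x) * u n (m + 1) x| + |u k m y - u k m x - (y - x) * u k (m + 1) x| := abs_sub _ _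
    _ ≤ A (m + 2) * |y - x| ^ 2 + A (m + 2) * |y - x| ^ 2 := add_le_add h1 h2
    _ = 2 * A (m + 2) * |y - x| ^ 2 := by ring

/-- **UNIFORM CAUCHY-NESS LIFTS ONE ORDER** (`a < b`): if `(u n m)_n` is uniformly Cauchy on `[a, b]` then so is `(u n (m+1))_n` —
given ε, take `h = min((b−a)∕2, ε∕(4(K+1)))` with `K = 2A(m+2)` (so `K·h ≤ ε∕4`), then `N` with `|u n m − u k m| ≤ εh∕8` on the
segment for `n, k ≥ N`; the interpolation step gives `|u n (m+1) − u k (m+1)| ≤ ε∕4 + ε∕4 < ε`. [folklore] -/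
theorem uniformCauchySeqOn_succ (hab : a < b) (m : ℕ)
    (hC : UniformCauchySeqOn (fun n => u n m) atTop (Icc a b)) :
    UniformCauchySeqOn (fun n => u n (m + 1)) atTop (Icc a b) := by
  rw [Metric.uniformCauchySeqOn_iff] at hC ⊢
  intro ε hε
  have ha : a ∈ Icc a b := ⟨le_rfl, hab.le⟩
  have hK : 0 ≤ 2 * A (m + 2) := by
    have := (abs_nonneg _).trans (hA 0 (m + 2) a ha)
    positivity
  set K : ℝ := 2 * A (m + 2) with hKdef
  set h : ℝ := min ((b - a) / 2) (ε / (4 * (K + 1))) with hhdef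
  have hh : 0 < h := lt_min (by linarith) (by positivity)
  have hh2 : a + 2 * h ≤ b := by
    have : h ≤ (b - a) / 2 := min_le_left _ _
    linarith
  have hKh : K * h ≤ ε / 4 := by
    have h4 : 0 < 4 * (K + 1) := by positivity
    calc K * h ≤ K * (ε / (4 * (K + 1))) := mul_le_mul_of_nonneg_left (min_le_right _ _) hK
      _ = K * ε / (4 * (K + 1)) := by ring
      _ ≤ ε / 4 := by
          rw [div_le_div_iff₀ h4 (by norm_num : (0 : ℝ) < 4)]
          nlinarith [mul_nonneg hK hε.le]
  obtain ⟨N, hN⟩ := hC (ε * h / 8) (by positivity)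
  refine ⟨N, fun n hn k hk x hx => ?_⟩
  have hG : ∀ y ∈ Icc a b, |u n m y - u k m y| ≤ ε * h / 8 := fun y hy => by
    have := hN n hn k hk y hy
    rw [Real.dist_eq] at this
    exact this.le
  have hI := abs_le_interpolation (g := fun y => u n m y - u k m y) (g' := fun y => u n (m + 1) y - u k (m + 1) y)
    (fun x hx y hy => fam_diff_taylor2 hu hA n k m hx hy) hG hh hh2 hx
  rw [Real.dist_eq]
  calc |u n (m + 1) x - u k (m + 1) x| ≤ 2 * (ε * h / 8) / h + K * h := hI
    _ = ε / 4 + K * h := by field_simp; ring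
    _ ≤ ε / 4 + ε / 4 := by linarith
    _ < ε := by linarith

/-- … hence uniform Cauchy-ness at order 0 gives it at EVERY order. [folklore] -/
theorem uniformCauchySeqOn_all (hab : a < b) (h0 : UniformCauchySeqOn (fun n => u n 0) atTop (Icc a b)) (m : ℕ) :
    UniformCauchySeqOn (fun n => u n m) atTop (Icc a b) := by
  induction m with
  | zero => exact h0
  | succ m ih => exact uniformCauchySeqOn_succ hu hA hab m ih

/-- **THE LIMIT OF A NORMAL FAMILY ON THE SEGMENT IS C^∞ ON THE CLOSED SEGMENT, WITH THE SAME BOUNDS, AND EVERY ORDER CONVERGES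
UNIFORMLY.**  If `u · 0 → f` uniformly on `[a, b]` (`a < b`) then there are functions `D m` (`D 0 = f` on `[a, b]`) with
`u · m → D m` UNIFORMLY on `[a, b]` for every `m`, `|D m| ≤ A m`, `|D m(y) − D m(x) − (y−x)·D (m+1)(x)| ≤ A (m+2)·|y−x|²`, and
`HasDerivWithinAt (D m) (D (m+1) x) (Icc a b) x` at every `x ∈ [a, b]`.  (Uniform Cauchy at every order by `uniformCauchySeqOn_all`;
limits by completeness of ℝ; the bounds and the quadratic Taylor bound pass to the limit pointwise; the latter is `o(y − x)`.)
No compactness argument beyond the hypothesis, no Arzelà–Ascoli, no Vitali–Montel. [folklore] -/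
theorem allOrders_limit (hab : a < b) {f : ℝ → ℝ} (h0 : TendstoUniformlyOn (fun n => u n 0) f atTop (Icc a b)) :
    ∃ D : ℕ → ℝ → ℝ, (∀ x ∈ Icc a b, D 0 x = f x) ∧
      (∀ m, TendstoUniformlyOn (fun n => u n m) (D m) atTop (Icc a b)) ∧
      (∀ m, ∀ x ∈ Icc a b, |D m x| ≤ A m) ∧
      (∀ m, ∀ x ∈ Icc a b, ∀ y ∈ Icc a b, |D m y - D m x - (y - x) * D (m + 1) x| ≤ A (m + 2) * |y - x| ^ 2) ∧
      (∀ m, ∀ x ∈ Icc a b, HasDerivWithinAt (D m) (D (m + 1) x) (Icc a b) x) := by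
  have hUC : ∀ m, UniformCauchySeqOn (fun n => u n m) atTop (Icc a b) :=
    uniformCauchySeqOn_all hu hA hab h0.uniformCauchySeqOn
  have hex : ∀ m, ∀ x ∈ Icc a b, ∃ l, Tendsto (fun n => u n m x) atTop (𝓝 l) := fun m x hx =>
    cauchySeq_tendsto_of_complete ((hUC m).cauchySeq hx)
  refine ⟨fun m x => limUnder atTop (fun n => u n m x), ?_⟩
  set D : ℕ → ℝ → ℝ := fun m x => limUnder atTop (fun n => u n m x) with hDdef
  have hD : ∀ m, ∀ x ∈ Icc a b, Tendsto (fun n => u n m x) atTop (𝓝 (D m x)) := fun m x hx =>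
    tendsto_nhds_limUnder (hex m x hx)
  have hTU : ∀ m, TendstoUniformlyOn (fun n => u n m) (D m) atTop (Icc a b) := fun m =>
    (hUC m).tendstoUniformlyOn_of_tendsto (hD m)
  have hD0 : ∀ x ∈ Icc a b, D 0 x = f x := fun x hx =>
    tendsto_nhds_unique (hD 0 x hx) (h0.tendsto_at hx)
  have hDA : ∀ m, ∀ x ∈ Icc a b, |D m x| ≤ A m := fun m x hx =>
    le_of_tendsto' (hD m x hx).abs fun n => hA n m x hx
  have hDT : ∀ m, ∀ x ∈ Icc a b, ∀ y ∈ Icc a b,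
      |D m y - D m x - (y - x) * D (m + 1) x| ≤ A (m + 2) * |y - x| ^ 2 := fun m x hx y hy => by
    have ht : Tendsto (fun n => u n m y - u n m x - (y - x) * u n (m + 1) x) atTop
        (𝓝 (D m y - D m x - (y - x) * D (m + 1) x)) :=
      ((hD m y hy).sub (hD m x hx)).sub (tendsto_const_nhds.mul (hD (m + 1) x hx))
    exact le_of_tendsto' ht.abs fun n => fam_taylor2 hu hA n m hx hy
  have hDd : ∀ m, ∀ x ∈ Icc a b, HasDerivWithinAt (D m) (D (m + 1) x) (Icc a b) x := fun m x hx => by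
    rw [hasDerivWithinAt_iff_isLittleO]
    have hbig : (fun y => D m y - D m x - (y - x) • D (m + 1) x) =O[𝓝[Icc a b] x] fun y => ‖y - x‖ ^ 2 := by
      refine IsBigO.of_bound (A (m + 2)) ?_
      filter_upwards [self_mem_nhdsWithin] with y hy
      rw [smul_eq_mul, Real.norm_eq_abs, Real.norm_of_nonneg (by positivity), Real.norm_eq_abs]
      exact hDT m x hx y hy
    exact hbig.trans_isLittleO ((isLittleO_pow_sub_sub x one_lt_two).mono nhdsWithin_le_nhds)
  exact ⟨hD0, hTU, hDA, hDT, hDd⟩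

end Family

/-! ## §3 Necessity: the uniform bound TWO orders up is load-bearing -/

/-- **(U1) + A UNIFORM FIRST-ORDER BOUND ⇏ COEFFICIENT CONVERGENCE.**  The family β_n(s) = sin((n+1)s)∕(n+1) converges to 0
UNIFORMLY on [0, 1], every β_n is differentiable with |β_n′| = |cos((n+1)s)| ≤ 1 uniformly in n, yet β_n′(0) = 1 for every n while the
limit 0 has derivative 0 at 0: «β_{n,2} → β′(0)» FAILS.  What §2 consumes is the bound TWO orders up (here |β_n″| ≤ n + 1, not uniform);
on the Erice side that bound is Cauchy's (m+2)!·M∕ρ^{m+2}, i.e. exactly the UNIFORMITY of (ρ, M) in n. [folklore witness] -/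
theorem unifConv_firstOrder_not_sufficient :
    ∃ β : ℕ → ℝ → ℝ, TendstoUniformlyOn β (fun _ => 0) atTop (Icc (0 : ℝ) 1) ∧
      (∀ n x, HasDerivAt (β n) (Real.cos ((n + 1) * x)) x) ∧
      (∀ (n : ℕ) (x : ℝ), |Real.cos ((n + 1) * x)| ≤ 1) ∧
      (∀ n, deriv (β n) 0 = 1) ∧ HasDerivAt (fun _ : ℝ => (0 : ℝ)) 0 0 := by
  have hd : ∀ (n : ℕ) (x : ℝ),
      HasDerivAt (fun x : ℝ => Real.sin ((n + 1) * x) / (n + 1)) (Real.cos ((n + 1) * x)) x := by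
    intro n x
    have hn1 : (n : ℝ) + 1 ≠ 0 := by positivity
    have h1 : HasDerivAt (fun x : ℝ => (n + 1) * x) ((n + 1) * 1) x := (hasDerivAt_id x).const_mul _
    have h3 := (h1.sin).div_const ((n : ℝ) + 1)
    have e : Real.cos ((n + 1) * x) * ((n + 1) * 1) / (n + 1) = Real.cos ((n + 1) * x) := by field_simp
    rw [e] at h3
    exact h3
  refine ⟨fun n x => Real.sin ((n + 1) * x) / (n + 1), ?_, hd, fun n x => Real.abs_cos_le_one _, fun n => ?_,
    hasDerivAt_const 0 0⟩
  · rw [Metric.tendstoUniformlyOn_iff]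
    intro ε hε
    obtain ⟨N, hN⟩ := exists_nat_gt (1 / ε)
    filter_upwards [eventually_ge_atTop N] with n hn x _
    have hn1 : (0 : ℝ) < n + 1 := by positivity
    have hNε : 1 / ε < n + 1 := hN.trans_le (by exact_mod_cast Nat.le_succ_of_le hn)
    rw [Real.dist_eq, zero_sub, abs_neg, abs_div, abs_of_pos hn1, div_lt_iff₀ hn1]
    calc |Real.sin ((n + 1) * x)| ≤ 1 := Real.abs_sin_le_one _
      _ = 1 / ε * ε := by field_simp
      _ < (n + 1) * ε := mul_lt_mul_of_pos_right hNε hε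
      _ = ε * (n + 1) := by ring
  · show deriv (fun x : ℝ => Real.sin ((n + 1) * x) / (n + 1)) 0 = 1
    rw [(hd n 0).deriv, mul_zero, Real.cos_zero]

/-! ## END -/

/-- **END — THE SEGMENT NORMAL-FAMILY CENSUS.**  (a) `allOrders_limit`: a family with within-derivatives of every order on `[a, b]`
(a < b) and ONE n-free bound per order, converging uniformly at order 0, converges UNIFORMLY at EVERY order to a C^∞ limit with the
same bounds and the quadratic Taylor bound at every base point; (b) the witness of §3: uniform convergence and a uniform bound ONE
order up alone do not move one derivative at one point. [folklore] -/
theorem segmentNormalFamily_census {u : ℕ → ℕ → ℝ → ℝ} {A : ℕ → ℝ} {a b : ℝ} (hab : a < b)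
    (hu : ∀ n m, ∀ x ∈ Icc a b, HasDerivWithinAt (u n m) (u n (m + 1) x) (Icc a b) x)
    (hA : ∀ n m, ∀ x ∈ Icc a b, |u n m x| ≤ A m) {f : ℝ → ℝ}
    (h0 : TendstoUniformlyOn (fun n => u n 0) f atTop (Icc a b)) :
    (∃ D : ℕ → ℝ → ℝ, (∀ x ∈ Icc a b, D 0 x = f x) ∧
      (∀ m, TendstoUniformlyOn (fun n => u n m) (D m) atTop (Icc a b)) ∧
      (∀ m, ∀ x ∈ Icc a b, |D m x| ≤ A m) ∧
      (∀ m, ∀ x ∈ Icc a b, ∀ y ∈ Icc a b, |D m y - D m x - (y - x) * D (m + 1) x| ≤ A (m + 2) * |y - x| ^ 2) ∧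
      (∀ m, ∀ x ∈ Icc a b, HasDerivWithinAt (D m) (D (m + 1) x) (Icc a b) x)) ∧
    (∃ β : ℕ → ℝ → ℝ, TendstoUniformlyOn β (fun _ => 0) atTop (Icc (0 : ℝ) 1) ∧
      (∀ n x, HasDerivAt (β n) (Real.cos ((n + 1) * x)) x) ∧ (∀ (n : ℕ) (x : ℝ), |Real.cos ((n + 1) * x)| ≤ 1) ∧
      (∀ n, deriv (β n) 0 = 1) ∧ HasDerivAt (fun _ : ℝ => (0 : ℝ)) 0 0) :=
  ⟨allOrders_limit hu hA hab h0, unifConv_firstOrder_not_sufficient⟩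

end Summit.QuantumFields.BalabanUV.Beta.EriceRemainderEnclosureSegmentNormalFamily

end
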